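import Literature.Analysis.FluidPDE.TorusClassicalH3Balance
import Literature.Analysis.FunctionSpaces.TorusConvectionLaplacianNormSq
import HarnessLib

/-!
# `H³` smoothing of classical Navier–Stokes solutions on `T³` under an `H²` bound

Analysis/FluidPDE proof file (theorems only; no definitions, no named facts), sequel of
`TorusClassicalNSH2Smoothing.lean` (the `H²` step: an enstrophy bound on `[a, a + τ]` bounds
`‖Δu(a + τ)‖₂`), `TorusClassicalH3Balance.lean` (the balance `d/dt ½‖∇Δu‖₂²` and the flux bounds of
the `H²`/`H³` balances) and `FunctionSpaces/TorusConvectionLaplacianNormSq.lean`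
(`‖Δ((u·∇)u)‖₂² ≤ C (‖∇u‖₂² + ‖Δu‖₂²)(‖Δu‖₂² + ‖∇Δu‖₂²)`, `‖∂ₖu‖²_∞ ≤ K (‖Δu‖₂² + ‖∇Δu‖₂²)`). For a
classical solution `(u, p)` of the forced incompressible Navier–Stokes system on `T^d × [a, a + τ]`,
`card d = 3`, `ν > 0`, with zero-mean velocity slices, the main theorem
`Torus.IsClassicalNSSolutionOn.gradNormSq_laplacian_le_of_le` is the QUANTITATIVE PARABOLIC SMOOTHING
ESTIMATE in `H³`:

`sup_{[a,a+τ]} ‖∇u‖₂² ≤ E₁`, `sup ‖Δu‖₂² ≤ Y₁`, `sup ‖∇f‖₂² ≤ G`, `sup ‖Δf‖₂² ≤ G₂`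
  ⟹ `‖∇Δu(a + τ)‖₂² ≤ C(d, ν, E₁, Y₁, G, G₂, τ)`,

with a constant independent of `a`, of the solution and of `‖∇Δu(a)‖₂` — the `k = 3` step of the
regularity ladder of strong solutions (Robinson–Rodrigo–Sadowski 2016, Thm 7.1: the differential
inequality (7.3) `d/dt ‖u‖²_{H^k} ≤ c ‖u‖²_{H^k} ‖u‖²_{H^k}` is LINEAR in the top order for `k ≥ 3` once
`‖u‖_{H^{k-1}}` is bounded, with `∫ ‖u‖²_{H^k} < ∞` from the previous level; Thm 7.3/7.5: start from a
time at which `u ∈ H^k`; Constantin–Foias 1988, Thm 10.6, the periodic case). Chained after the `H²`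
step it makes compact invariant sets of strong solutions bounded in `H³`, hence (corollary
`Torus.IsClassicalNSSolutionOn.norm_partialDeriv_le_of_le`, via `Torus.norm_partialDeriv_sq_le_of_isSmooth`)
bounded in `W^{1,∞}` — the coefficient bounds `‖∂ᵢu‖ ≤ Cᵢ` of the `H → V` smoothing estimates of the
linearised and difference equations (`TorusLinearisedNSSmoothing`, `TorusClassicalNSDifferenceSmoothing`).

Proof road (no time integrals), `Y = ‖Δu‖₂²`, `Z = ‖∇Δu‖₂²`: (i) `(½Y)' ≤ −(ν/2)Z + A₂`
(`….laplacian_flux_le_half`); by the Lagrange mean value theorem on `[a, a + τ/2]` there is `ξ` with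
`(½Y)'(ξ) ≥ −Y₁/τ`, whence `Z(ξ) ≤ L = (2/ν)(A₂ + Y₁/τ)`; (ii) `(½Z)' ≤ ν⁻¹(G₂ + ‖Δ((u·∇)u)‖₂²) ≤ α + β·½Z`
(`….gradNormSq_laplacian_flux_le`, `Torus.integral_norm_laplacian_convect_self_sq_le`); (iii) hence
`Ψ = log(A + ½Z)`, `A = α/(β+1) + 1`, has `Ψ' ≤ β + 1`, and the fencing lemma
(`image_le_of_deriv_right_le_deriv_boundary`) on `[ξ, a + τ]` gives `A + ½Z(a + τ) ≤ (A + L/2) e^{(β+1)τ}`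
(Grönwall in logarithmic form, as in the `H²` step).
Deliberately NOT here: the `H^m` ladder for `m ≥ 4`, time derivatives, existence of solutions.

## Mathlib / tree search

Tree (reused): `Torus.IsClassicalNSSolutionOn.hasDerivWithinAt_half_integral_norm_laplacian_sq`
(`TorusClassicalNSH2Smoothing`), `….hasDerivWithinAt_half_gradNormSq_laplacian`, `….laplacian_flux_le_half`,
`….gradNormSq_laplacian_flux_le` (`TorusClassicalH3Balance`), `Torus.integral_norm_laplacian_convect_self_sq_le`,
`Torus.norm_partialDeriv_sq_le_of_isSmooth` (`TorusConvectionLaplacianNormSq`); Mathlib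
`exists_hasDerivAt_eq_slope`, `image_le_of_deriv_right_le_deriv_boundary`, `HasDerivWithinAt.log`.
Searched `gradNormSq (laplacian` with `≤`, `H3`, `smoothing` for classical torus solutions: only the `H²`
step (`TorusClassicalNSH2Smoothing`) and the `ℝ³` cutoff version `NSH1BoundedSmoothing`.

## References

* J. C. Robinson, J. L. Rodrigo, W. Sadowski, *The Three-Dimensional Navier–Stokes Equations*,
  CUP 2016, Thm 7.1 ((7.3)), Thm 7.3, Thm 7.5. [RobinsonRodrigoSadowskiCUP2016]
* P. Constantin, C. Foias, *Navier–Stokes Equations*, Univ. Chicago Press 1988, Ch. 10,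
  Thm 10.6 (periodic case). [ConstantinFoiasNSE1988]
-/

noncomputable section

open MeasureTheory Set Function Filter
open scoped ContDiff InnerProductSpace RealInnerProductSpace Topology NNReal

namespace Literature.Analysis.FluidPDE

open Literature.Analysis.FunctionSpaces

variable {d : Type*} [Fintype d] [DecidableEq d]

/-! ### The smoothing estimate -/

set_option maxHeartbeats 400000 in
/-- **Quantitative `H³` smoothing of classical Navier–Stokes solutions on `T³` under an `H²` bound**
(Robinson–Rodrigo–Sadowski 2016, Thm 7.1 with Thm 7.3/7.5, `k = 3`; Constantin–Foias 1988, Thm 10.6,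
periodic case): on `T^d` with `card d = 3`, for `ν > 0`, levels `E₁, Y₁` (of `‖∇u‖₂²`, `‖Δu‖₂²`), force
levels `G, G₂` (of `‖∇f‖₂²`, `‖Δf‖₂²`) and a time lapse `τ > 0` there is a constant `C` such that for
EVERY classical solution `(u, p)` of the Navier–Stokes system with force `f` on `[a, a + τ] × T^d` whose
velocity slices have zero mean, `‖∇u(t)‖₂² ≤ E₁`, `∫ ‖Δu(t)‖² ≤ Y₁`, `‖∇f(t)‖₂² ≤ G` and `∫ ‖Δf(t)‖² ≤ G₂`
for `t ∈ [a, a + τ]`, one has `‖∇Δu(a + τ)‖₂² ≤ C` — uniformly in `a`, in the solution and in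
`‖∇Δu(a)‖₂`. Proof: a time `ξ ∈ (a, a + τ/2)` with `‖∇Δu(ξ)‖₂² ≤ L` from the Lagrange mean value theorem
applied to `½‖Δu‖₂²` (whose derivative is `≤ −(ν/2)‖∇Δu‖₂² + A₂`, `laplacian_flux_le_half`), then the
fencing lemma for `log(A + ½‖∇Δu‖₂²)`, whose derivative is bounded by the constant `β + 1` because that of
`½‖∇Δu‖₂²` is `≤ α + β · ½‖∇Δu‖₂²` (`gradNormSq_laplacian_flux_le` and
`Torus.integral_norm_laplacian_convect_self_sq_le`).
[cite: RobinsonRodrigoSadowskiCUP2016, Thm 7.1 and Thm 7.5] -/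
theorem _root_.Literature.Analysis.FunctionSpaces.Torus.IsClassicalNSSolutionOn.gradNormSq_laplacian_le_of_le
    (hd : Fintype.card d = 3) {ν : ℝ} (hν : 0 < ν) (E₁ Y₁ G G₂ : ℝ) {τ : ℝ} (hτ : 0 < τ) :
    ∃ C : ℝ, ∀ {a : ℝ} {f u : ℝ → UnitAddTorus d → EuclideanSpace ℝ d} {p : ℝ → UnitAddTorus d → ℝ},
      Torus.IsClassicalNSSolutionOn (Icc a (a + τ)) ν f u p →
      (∀ t ∈ Icc a (a + τ), Torus.HasZeroMean (u t)) →
      (∀ t ∈ Icc a (a + τ), Torus.gradNormSq (u t) ≤ E₁) →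
      (∀ t ∈ Icc a (a + τ), ∫ x, ‖Torus.laplacian (u t) x‖ ^ 2 ≤ Y₁) →
      (∀ t ∈ Icc a (a + τ), Torus.gradNormSq (f t) ≤ G) →
      (∀ t ∈ Icc a (a + τ), ∫ x, ‖Torus.laplacian (f t) x‖ ^ 2 ≤ G₂) →
        Torus.gradNormSq (Torus.laplacian (u (a + τ))) ≤ C := by
  obtain ⟨C₂, hC₂0, hC₂⟩ := Torus.IsClassicalNSSolutionOn.laplacian_flux_le_half (d := d) hd
  obtain ⟨C₃, hC₃0, hC₃⟩ := Torus.integral_norm_laplacian_convect_self_sq_le (d := d) hd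
  have hν0 : ν ≠ 0 := hν.ne'
  -- the constants (all depend on `d, ν, E₁, Y₁, G, G₂, τ` only)
  set E₁' : ℝ := max E₁ 0 with hE₁'
  set Y₁' : ℝ := max Y₁ 0 with hY₁'
  set G' : ℝ := max G 0 with hG'
  set G₂' : ℝ := max G₂ 0 with hG₂'
  have hE₁'0 : 0 ≤ E₁' := le_max_right _ _
  have hY₁'0 : 0 ≤ Y₁' := le_max_right _ _
  have hG'0 : 0 ≤ G' := le_max_right _ _
  have hG₂'0 : 0 ≤ G₂' := le_max_right _ _
  set A₂ : ℝ := ν⁻¹ * (G' + C₂ * (E₁' + Y₁') * Y₁') with hA₂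
  have hA₂0 : 0 ≤ A₂ := by positivity
  set L : ℝ := 2 / ν * (A₂ + Y₁' / τ) with hL
  have hL0 : 0 ≤ L := by positivity
  set α : ℝ := ν⁻¹ * (G₂' + C₃ * (E₁' + Y₁') * Y₁') with hα
  have hα0 : 0 ≤ α := by positivity
  set β : ℝ := 2 * ν⁻¹ * (C₃ * (E₁' + Y₁')) with hβ
  have hβ0 : 0 ≤ β := by positivity
  refine ⟨(2 * (α / (β + 1) + 1) + L) * Real.exp ((β + 1) * τ), fun {a f u p} h h0 hE hY hG hG₂ => ?_⟩
  set b : ℝ := a + τ with hb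
  have hab : a < b := by rw [hb]; linarith
  -- notation for the two quantities along the solution
  set Y : ℝ → ℝ := fun s => ∫ x, ‖Torus.laplacian (u s) x‖ ^ 2 with hYdef
  set Z : ℝ → ℝ := fun s => Torus.gradNormSq (Torus.laplacian (u s)) with hZdef
  set Yh' : ℝ → ℝ := fun s => -ν * Torus.gradNormSq (Torus.laplacian (u s)) -
    ∫ x, ⟪Torus.convect (u s) (u s) x - f s x, Torus.laplacian (Torus.laplacian (u s)) x⟫ with hYh'
  set Zh' : ℝ → ℝ := fun s => -ν * (∫ x, ‖Torus.laplacian (Torus.laplacian (u s)) x‖ ^ 2) +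
    ∫ x, ⟪Torus.convect (u s) (u s) x - f s x,
      Torus.laplacian (Torus.laplacian (Torus.laplacian (u s))) x⟫ with hZh'
  have hY0 : ∀ s, 0 ≤ Y s := fun s => integral_nonneg fun x => sq_nonneg _
  have hZ0 : ∀ s, 0 ≤ Z s := fun s => Torus.gradNormSq_nonneg _
  have hE' : ∀ s ∈ Icc a b, Torus.gradNormSq (u s) ≤ E₁' := fun s hs => (hE s hs).trans (le_max_left _ _)
  have hY' : ∀ s ∈ Icc a b, Y s ≤ Y₁' := fun s hs => (hY s hs).trans (le_max_left _ _)
  have hG'' : ∀ s ∈ Icc a b, Torus.gradNormSq (f s) ≤ G' := fun s hs => (hG s hs).trans (le_max_left _ _)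
  have hG₂'' : ∀ s ∈ Icc a b, ∫ x, ‖Torus.laplacian (f s) x‖ ^ 2 ≤ G₂' := fun s hs =>
    (hG₂ s hs).trans (le_max_left _ _)
  -- the two balances and their flux bounds
  have hdY : ∀ s ∈ Icc a b, HasDerivWithinAt (fun r => 2⁻¹ * Y r) (Yh' s) (Icc a b) s := fun s hs =>
    h.hasDerivWithinAt_half_integral_norm_laplacian_sq hab hs
  have hdZ : ∀ s ∈ Icc a b, HasDerivWithinAt (fun r => 2⁻¹ * Z r) (Zh' s) (Icc a b) s := fun s hs =>
    h.hasDerivWithinAt_half_gradNormSq_laplacian hab hs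
  have hYh'le : ∀ s ∈ Icc a b, Yh' s ≤ -(ν / 2) * Z s + A₂ := by
    intro s hs
    have h1 := hC₂ ν hν h hab hs (h0 s hs)
    have h2 : C₂ * (Torus.gradNormSq (u s) + Y s) * Y s ≤ C₂ * (E₁' + Y₁') * Y₁' := by
      have h3 : Torus.gradNormSq (u s) + Y s ≤ E₁' + Y₁' := add_le_add (hE' s hs) (hY' s hs)
      have h4 : 0 ≤ Torus.gradNormSq (u s) + Y s := add_nonneg (Torus.gradNormSq_nonneg _) (hY0 s)
      calc C₂ * (Torus.gradNormSq (u s) + Y s) * Y s ≤ C₂ * (E₁' + Y₁') * Y s :=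
            mul_le_mul_of_nonneg_right (mul_le_mul_of_nonneg_left h3 hC₂0) (hY0 s)
        _ ≤ C₂ * (E₁' + Y₁') * Y₁' := mul_le_mul_of_nonneg_left (hY' s hs) (by positivity)
    have h5 : ν⁻¹ * (Torus.gradNormSq (f s) + C₂ * (Torus.gradNormSq (u s) + Y s) * Y s) ≤ A₂ := by
      rw [hA₂]
      exact mul_le_mul_of_nonneg_left (add_le_add (hG'' s hs) h2) (inv_pos.2 hν).le
    calc Yh' s ≤ -(ν / 2) * Z s + ν⁻¹ * (Torus.gradNormSq (f s) + C₂ * (Torus.gradNormSq (u s) + Y s) * Y s) := h1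
      _ ≤ -(ν / 2) * Z s + A₂ := by linarith
  have hZh'le : ∀ s ∈ Icc a b, Zh' s ≤ α + β * (2⁻¹ * Z s) := by
    intro s hs
    have hus : Torus.IsSmooth (u s) := h.smooth_velocity.isSmooth_slice hs
    have h1 := h.gradNormSq_laplacian_flux_le hν hab hs
    have h2 := hC₃ (u s) hus (h0 s hs)
    have hW0 : 0 ≤ ∫ x, ‖Torus.laplacian (Torus.laplacian (u s)) x‖ ^ 2 := integral_nonneg fun x => sq_nonneg _
    have h3 : C₃ * (Torus.gradNormSq (u s) + Y s) * (Y s + Z s) ≤ C₃ * (E₁' + Y₁') * (Y₁' + Z s) := by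
      have h4 : Torus.gradNormSq (u s) + Y s ≤ E₁' + Y₁' := add_le_add (hE' s hs) (hY' s hs)
      have h5 : 0 ≤ Y s + Z s := add_nonneg (hY0 s) (hZ0 s)
      calc C₃ * (Torus.gradNormSq (u s) + Y s) * (Y s + Z s) ≤ C₃ * (E₁' + Y₁') * (Y s + Z s) :=
            mul_le_mul_of_nonneg_right (mul_le_mul_of_nonneg_left h4 hC₃0) h5
        _ ≤ C₃ * (E₁' + Y₁') * (Y₁' + Z s) :=
            mul_le_mul_of_nonneg_left (add_le_add (hY' s hs) le_rfl) (by positivity)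
    have h6 : ν⁻¹ * ((∫ x, ‖Torus.laplacian (f s) x‖ ^ 2) + ∫ x, ‖Torus.laplacian (Torus.convect (u s) (u s)) x‖ ^ 2) ≤
        ν⁻¹ * (G₂' + C₃ * (E₁' + Y₁') * (Y₁' + Z s)) :=
      mul_le_mul_of_nonneg_left (add_le_add (hG₂'' s hs) (h2.trans h3)) (inv_pos.2 hν).le
    have h7 : ν⁻¹ * (G₂' + C₃ * (E₁' + Y₁') * (Y₁' + Z s)) = α + β * (2⁻¹ * Z s) := by
      rw [hα, hβ]; ring
    have h8 : 0 ≤ ν / 2 * ∫ x, ‖Torus.laplacian (Torus.laplacian (u s)) x‖ ^ 2 :=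
      mul_nonneg (by positivity) hW0
    calc Zh' s ≤ -(ν / 2) * (∫ x, ‖Torus.laplacian (Torus.laplacian (u s)) x‖ ^ 2) +
          ν⁻¹ * ((∫ x, ‖Torus.laplacian (f s) x‖ ^ 2) +
            ∫ x, ‖Torus.laplacian (Torus.convect (u s) (u s)) x‖ ^ 2) := h1
      _ ≤ ν⁻¹ * (G₂' + C₃ * (E₁' + Y₁') * (Y₁' + Z s)) := by linarith [h6, h8]
      _ = α + β * (2⁻¹ * Z s) := h7
  -- Step 1: a time `ξ ∈ (a, a + τ/2)` with `Z ξ ≤ L` (Lagrange on `½‖Δu‖₂²`)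
  set m : ℝ := a + τ / 2 with hm
  have ham : a < m := by rw [hm]; linarith
  have hmb : m < b := by rw [hm, hb]; linarith
  have hmmem : Icc a m ⊆ Icc a b := Icc_subset_Icc le_rfl hmb.le
  obtain ⟨ξ, hξ, hslope⟩ : ∃ ξ ∈ Ioo a m, Yh' ξ = (2⁻¹ * Y m - 2⁻¹ * Y a) / (m - a) := by
    refine exists_hasDerivAt_eq_slope (fun r => 2⁻¹ * Y r) Yh' ham ?_ ?_
    · exact fun s hs => ((hdY s (hmmem hs)).continuousWithinAt).mono hmmem
    · intro s hs
      exact (hdY s (hmmem (Ioo_subset_Icc_self hs))).hasDerivAt (Icc_mem_nhds hs.1 (hs.2.trans hmb))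
  have hξab : ξ ∈ Icc a b := ⟨hξ.1.le, (hξ.2.trans hmb).le⟩
  have hZξ : Z ξ ≤ L := by
    have hsl : -(Y₁' / τ) ≤ Yh' ξ := by
      rw [hslope, le_div_iff₀ (sub_pos.2 ham)]
      have hma : m - a = τ / 2 := by rw [hm]; ring
      have h1 : 2⁻¹ * Y a ≤ 2⁻¹ * Y₁' := mul_le_mul_of_nonneg_left (hY' a (left_mem_Icc.2 hab.le)) (by norm_num)
      have h2 : 0 ≤ 2⁻¹ * Y m := mul_nonneg (by norm_num) (hY0 m)
      have h5 : -(Y₁' / τ) * (τ / 2) = -(2⁻¹ * Y₁') := by field_simp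
      rw [hma, h5]
      linarith
    have h3 := hYh'le ξ hξab
    have h4 : ν / 2 * Z ξ ≤ A₂ + Y₁' / τ := by linarith
    calc Z ξ = 2 / ν * (ν / 2 * Z ξ) := by field_simp
      _ ≤ 2 / ν * (A₂ + Y₁' / τ) := mul_le_mul_of_nonneg_left h4 (by positivity)
  -- Step 2: the Lyapunov function `Ψ = log (A + ½Z)` has `Ψ' ≤ β'` (`β' = β + 1`, `A = α/β' + 1`)
  set β' : ℝ := β + 1 with hβ'
  have hβ'0 : 0 < β' := by rw [hβ']; linarith
  set A : ℝ := α / β' + 1 with hA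
  have hA0 : 0 < A := by rw [hA]; positivity
  have hβ'A : β' * A = α + β' := by rw [hA]; field_simp
  set Ψ : ℝ → ℝ := fun s => Real.log (A + 2⁻¹ * Z s) with hΨ
  set Ψ' : ℝ → ℝ := fun s => Zh' s / (A + 2⁻¹ * Z s) with hΨ'
  have hdΨ : ∀ s ∈ Icc a b, HasDerivWithinAt Ψ (Ψ' s) (Icc a b) s := by
    intro s hs
    have hpos : A + 2⁻¹ * Z s ≠ 0 := by have := hZ0 s; positivity
    have hlog := ((hasDerivWithinAt_const s (Icc a b) A).add (hdZ s hs)).log hpos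
    rw [zero_add] at hlog
    exact hlog
  have hΨ'le : ∀ s ∈ Icc a b, Ψ' s ≤ β' := by
    intro s hs
    have hZs := hZ0 s
    have hden : 0 < A + 2⁻¹ * Z s := by positivity
    have h1 := hZh'le s hs
    have h2 : β * (2⁻¹ * Z s) ≤ β' * (2⁻¹ * Z s) :=
      mul_le_mul_of_nonneg_right (by rw [hβ']; linarith) (by positivity)
    change Zh' s / (A + 2⁻¹ * Z s) ≤ β'
    rw [div_le_iff₀ hden]
    linarith [h1, h2, hβ'A]
  -- Step 3: fencing on `[ξ, b]`
  have hΨc : ContinuousOn Ψ (Icc ξ b) := fun s hs =>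
    ((hdΨ s ⟨hξab.1.trans hs.1, hs.2⟩).continuousWithinAt).mono (Icc_subset_Icc hξab.1 le_rfl)
  have hΨr : ∀ s ∈ Ico ξ b, HasDerivWithinAt Ψ (Ψ' s) (Ici s) s := fun s hs =>
    ((hdΨ s ⟨hξab.1.trans hs.1, hs.2.le⟩).mono (Icc_subset_Icc (hξab.1.trans hs.1) le_rfl)).mono_of_mem_nhdsWithin
      (Icc_mem_nhdsGE hs.2)
  have hfence := image_le_of_deriv_right_le_deriv_boundary hΨc hΨr
    (B := fun s => Ψ ξ + β' * (s - ξ)) (B' := fun _ => β') (by simp)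
    (by fun_prop)
    (fun s _ => by
      have h1 : HasDerivWithinAt (fun r => Ψ ξ + β' * (r - ξ)) (0 + β' * (1 - 0)) (Ici s) s :=
        (hasDerivWithinAt_const _ _ _).add (((hasDerivWithinAt_id _ _).sub
          (hasDerivWithinAt_const _ _ _)).const_mul β')
      simpa using h1)
    (fun s hs => hΨ'le s ⟨hξab.1.trans hs.1, hs.2.le⟩) (right_mem_Icc.2 hξab.2)
  have hfence' : Ψ b ≤ Ψ ξ + β' * (b - ξ) := hfence
  -- Step 4: unwind `log (A + ½Z b) ≤ log (A + ½Z ξ) + β' (b - ξ) ≤ log (A + L/2) + β' τ`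
  have hΨξ : Ψ ξ ≤ Real.log (A + L / 2) := by
    change Real.log (A + 2⁻¹ * Z ξ) ≤ Real.log (A + L / 2)
    exact Real.log_le_log (by have := hZ0 ξ; positivity) (by linarith [hZξ])
  have hbξ : β' * (b - ξ) ≤ β' * τ := by
    refine mul_le_mul_of_nonneg_left ?_ hβ'0.le
    rw [hb]; linarith [hξ.1]
  have hlogb : Real.log (A + 2⁻¹ * Z b) ≤ Real.log (A + L / 2) + β' * τ := by
    have h1 : Real.log (A + 2⁻¹ * Z b) = Ψ b := rfl
    linarith [hfence', hΨξ, hbξ, h1]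
  have hAZb : 0 < A + 2⁻¹ * Z b := by have := hZ0 b; positivity
  have hexp : A + 2⁻¹ * Z b ≤ (A + L / 2) * Real.exp (β' * τ) := by
    have h2 := Real.exp_le_exp.2 hlogb
    rwa [Real.exp_log hAZb, Real.exp_add, Real.exp_log (by positivity)] at h2
  calc Torus.gradNormSq (Torus.laplacian (u b)) = Z b := rfl
    _ ≤ 2 * (A + 2⁻¹ * Z b) := by linarith [hA0]
    _ ≤ 2 * ((A + L / 2) * Real.exp (β' * τ)) := by linarith [hexp]
    _ = (2 * (α / (β + 1) + 1) + L) * Real.exp ((β + 1) * τ) := by rw [hA, hβ']; ring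

/-! ### The sup bound of the gradient at the end of the window -/

/-- **Uniform `W^{1,∞}` bound at the end of the window** (corollary of the `H³` smoothing estimate and
the embedding `‖∂ₖu‖² ≤ K (‖Δu‖₂² + ‖∇Δu‖₂²)`, `Torus.norm_partialDeriv_sq_le_of_isSmooth`): under the
hypotheses of `….gradNormSq_laplacian_le_of_le` there is `M₁` (depending on `d, ν, E₁, Y₁, G, G₂, τ`
only) with `‖∂ₖu(a + τ, x)‖ ≤ M₁` for every `k` and `x`. These are the coefficient bounds `‖∂ᵢu‖ ≤ Cᵢ`
of the `H → V` smoothing estimates of the linearised and difference equations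
(`Torus.linearisedNS_sub_mul_gradNormSq_le`, `Torus.IsClassicalNSSolutionOn.sub_mul_gradNormSq_sub_le`).
[cite: RobinsonRodrigoSadowskiCUP2016, Thm 7.1 and Thm 7.5] -/
theorem _root_.Literature.Analysis.FunctionSpaces.Torus.IsClassicalNSSolutionOn.norm_partialDeriv_le_of_le
    (hd : Fintype.card d = 3) {ν : ℝ} (hν : 0 < ν) (E₁ Y₁ G G₂ : ℝ) {τ : ℝ} (hτ : 0 < τ) :
    ∃ M₁ : ℝ, ∀ {a : ℝ} {f u : ℝ → UnitAddTorus d → EuclideanSpace ℝ d} {p : ℝ → UnitAddTorus d → ℝ},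
      Torus.IsClassicalNSSolutionOn (Icc a (a + τ)) ν f u p →
      (∀ t ∈ Icc a (a + τ), Torus.HasZeroMean (u t)) →
      (∀ t ∈ Icc a (a + τ), Torus.gradNormSq (u t) ≤ E₁) →
      (∀ t ∈ Icc a (a + τ), ∫ x, ‖Torus.laplacian (u t) x‖ ^ 2 ≤ Y₁) →
      (∀ t ∈ Icc a (a + τ), Torus.gradNormSq (f t) ≤ G) →
      (∀ t ∈ Icc a (a + τ), ∫ x, ‖Torus.laplacian (f t) x‖ ^ 2 ≤ G₂) →
        ∀ (k : d) (x : UnitAddTorus d), ‖Torus.partialDeriv k (u (a + τ)) x‖ ≤ M₁ := by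
  obtain ⟨C, hC⟩ := Torus.IsClassicalNSSolutionOn.gradNormSq_laplacian_le_of_le (d := d) hd hν E₁ Y₁ G G₂ hτ
  obtain ⟨K, hK, hsup⟩ := Torus.norm_partialDeriv_sq_le_of_isSmooth (d := d) hd
  refine ⟨Real.sqrt (K * (max Y₁ 0 + C)), fun {a f u p} h h0 hE hY hG hG₂ k x => ?_⟩
  have hb : a + τ ∈ Icc a (a + τ) := right_mem_Icc.2 (by linarith)
  have hus : Torus.IsSmooth (u (a + τ)) := h.smooth_velocity.isSmooth_slice hb
  have h1 := hsup (u (a + τ)) hus k x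
  have h2 := hC h h0 hE hY hG hG₂
  have h3 : ∫ y, ‖Torus.laplacian (u (a + τ)) y‖ ^ 2 ≤ max Y₁ 0 := (hY _ hb).trans (le_max_left _ _)
  rw [← Real.sqrt_sq (norm_nonneg (Torus.partialDeriv k (u (a + τ)) x))]
  exact Real.sqrt_le_sqrt (h1.trans (mul_le_mul_of_nonneg_left (add_le_add h3 h2) hK.le))

end Literature.Analysis.FluidPDE

end
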